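import Mathlib
import Summits.Ventures.PercRepro.TriangleCapHungK4

/-!
# PercRepro — THE CAP ON THE CELL `(k, 4, 2)` WITH EVERY DEGREE `≥ 3` IS STRICT FOR EVERY `k ≥ 10` — at `K = 6` the
three non-neighbours may be pairwise adjacent, which the three pair bounds exclude (p3, gen 45; part 201c)

Part 201a's cap lemma assumed every degree `≥ 4` and `k ≥ 11`. Here (`four_two_cap_strict_three`, `k ≥ 10`, every
degree `≥ 3`): the count of part 198a, with, at `K = 6`, the triangle on the three non-neighbours excluded by
`2P ≤ 3 (K + 1)` against `P = 13 − M` (`E = 6` forces every vertex of `R` adjacent to the other two), so `E = 0`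
and `M ≤ 1`; at `M = 1` every matched vertex has `1 ≤ g ≤ 2` (its partner has degree `≥ 3` too and `g + g′ ≤ 3`),
which costs `2` per matched vertex against part 198a's per-vertex bound: `4` below the value. Axioms: standard.
-/

namespace PercRepro

namespace TriangleCap

namespace C047

open Finset

variable {V : Type*} [Fintype V] [DecidableEq V]

/-- **THE CAP ON THE CELL `(k, 4, 2)` WITH EVERY DEGREE `≥ 3`, `k ≥ 10`, IS STRICT:** a vertex `x` of degree `k − 4`
makes `D` `4`-bipartite or `Σ_v d(v)² + 2 (k − 3) + 2 (k − 9) + 2 ≤ m k` (in fact `4` below the value). -/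
theorem four_two_cap_strict_three (D : SimpleGraph V) [DecidableRel D.Adj] (hK : K4mFree D)
    (hk : 10 ≤ Fintype.card V) (hm : D.edgeFinset.card + 2 = 4 * (Fintype.card V - 4))
    (hdeg3 : ∀ v, 3 ≤ deg D v) (x : V) (hx : deg D x + 4 = Fintype.card V) :
    (∃ A : Finset V, A.card = 4 ∧ BipSub D A) ∨
      ∑ v, deg D v * deg D v + 2 * (Fintype.card V - 3) + 2 * (Fintype.card V - 9) + 2 ≤
        D.edgeFinset.card * Fintype.card V := by
  obtain ⟨N, hN⟩ : ∃ N : Finset V, N = univ.filter (fun w => D.Adj x w) := ⟨_, rfl⟩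
  have hmemN : ∀ w, w ∈ N ↔ D.Adj x w := fun w => by rw [hN, mem_filter]; simp only [mem_univ, true_and]
  have hxN : x ∉ N := fun h => D.irrefl ((hmemN x).mp h)
  have hdx : deg D x = N.card := by rw [hN]; rfl
  obtain ⟨K, hKdef⟩ : ∃ K, N.card = K := ⟨_, rfl⟩
  have hcardV : Fintype.card V = K + 4 := by omega
  obtain ⟨m, hmdef⟩ : ∃ m, D.edgeFinset.card = m := ⟨_, rfl⟩
  rw [hmdef, hcardV, Nat.add_sub_cancel] at hm
  obtain ⟨R, hR⟩ : ∃ R : Finset V, R = (insert x N)ᶜ := ⟨_, rfl⟩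
  have hRcard : R.card = 3 := by
    rw [hR, card_compl, card_insert_of_notMem hxN]
    omega
  have hmemR : ∀ w, w ∈ R ↔ w ≠ x ∧ ¬ D.Adj x w := by
    intro w
    rw [hR, mem_compl, mem_insert, hmemN]
    tauto
  obtain ⟨M, hM⟩ : ∃ M, adjPairs D N = 2 * M := ⟨_, adjPairs_eq_two_mul D N⟩
  have hTf : ∑ y ∈ N, degIn D N y = 2 * M := by rw [← adjPairs_eq_sum_degIn, hM]
  have hfle : ∀ y ∈ N, degIn D N y ≤ 1 := by
    intro y hy
    have h1 := degIn_nbhd_le_one D hK (x := x) (u := y) ((hmemN y).mp hy)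
    rw [← hN] at h1
    exact h1
  obtain ⟨P, hPdef⟩ : ∃ P, ∑ u ∈ R, degIn D N u = P := ⟨_, rfl⟩
  obtain ⟨E, hEdef⟩ : ∃ E, adjPairs D R = E := ⟨_, rfl⟩
  have hsplit : ∀ F : V → ℕ, ∑ w, F w = F x + ∑ y ∈ N, F y + ∑ u ∈ R, F u := by
    intro F
    rw [← sum_add_sum_compl (insert x N), sum_insert hxN, ← hR]
  have hdegN : ∀ y ∈ N, deg D y = 1 + degIn D N y + degIn D R y := by
    intro y hy
    have := deg_eq_of_mem_nbhd D x y ((hmemN y).mp hy)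
    rw [← hN, ← hR] at this
    exact this
  have hsumN : ∑ y ∈ N, deg D y = K + 2 * M + P := by
    rw [sum_congr rfl hdegN, sum_add_distrib, sum_add_distrib, sum_const, smul_eq_mul, mul_one, hKdef, hTf,
      sum_degIn_comm D N R, hPdef]
  have hdegR : ∀ u ∈ R, deg D u = degIn D N u + degIn D R u := by
    intro u hu
    have := deg_eq_of_not_mem_nbhd D x u ((hmemR u).mp hu).2
    rw [← hN, ← hR] at this
    exact this
  have hsumR : ∑ u ∈ R, deg D u = P + E := by
    rw [sum_congr rfl hdegR, sum_add_distrib, hPdef, ← adjPairs_eq_sum_degIn, hEdef]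
  have hdegsum := sum_deg_eq D
  rw [hsplit, hsumN, hsumR, hdx, hKdef, hmdef] at hdegsum
  have hPle : ∀ u ∈ R, degIn D N u + M ≤ K := by
    intro u hu
    have := two_mul_degIn_add_adjPairs_le D hK (x := x) ((hmemR u).mp hu).1
    rw [← hN, hM, hKdef] at this
    omega
  have h2 : P + 3 * M ≤ 3 * K := by
    have hs : ∑ u ∈ R, (degIn D N u + M) ≤ ∑ _u ∈ R, K := sum_le_sum hPle
    rw [sum_add_distrib, sum_const, sum_const, smul_eq_mul, smul_eq_mul, hPdef, hRcard] at hs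
    exact hs
  have hE6 : E ≤ 6 := by
    have := adjPairs_le_card_mul_pred D R
    rw [hEdef, hRcard] at this
    exact this
  have hnoedge : 1 ≤ E → P + M ≤ 2 * K + 1 := by
    intro hE
    obtain ⟨u, hu, hu1⟩ : ∃ u ∈ R, 1 ≤ degIn D R u := by
      by_contra hcon
      push Not at hcon
      have h0 : ∑ u ∈ R, degIn D R u = 0 := sum_eq_zero (fun u hu => by have := hcon u hu; omega)
      rw [← adjPairs_eq_sum_degIn, hEdef] at h0
      omega
    obtain ⟨v, hv, huv⟩ : ∃ v ∈ R, D.Adj u v := by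
      unfold degIn at hu1
      obtain ⟨v, hv⟩ := card_pos.mp hu1
      rw [mem_filter] at hv
      exact ⟨v, hv.1, hv.2⟩
    have hne : u ≠ v := D.ne_of_adj huv
    have hPuv : degIn D N u + degIn D N v ≤ K + 1 := by
      have := degIn_add_degIn_le_of_adj_pair D hK N huv
      rw [hKdef] at this
      exact this
    have hvR' : v ∈ R.erase u := mem_erase.mpr ⟨hne.symm, hv⟩
    have hsum1 := add_sum_erase R (fun w => degIn D N w) hu
    have hsum2 := add_sum_erase (R.erase u) (fun w => degIn D N w) hvR'
    have hcard2 : ((R.erase u).erase v).card = 1 := by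
      rw [card_erase_of_mem hvR', card_erase_of_mem hu]
      omega
    have hrest : ∑ w ∈ (R.erase u).erase v, degIn D N w + M ≤ K := by
      have hs : ∑ w ∈ (R.erase u).erase v, (degIn D N w + M) ≤ ∑ _w ∈ (R.erase u).erase v, K :=
        sum_le_sum (fun w hw => hPle w (mem_of_mem_erase (mem_of_mem_erase hw)))
      rw [sum_add_distrib, sum_const, sum_const, smul_eq_mul, smul_eq_mul, hcard2, one_mul, one_mul] at hs
      exact hs
    rw [hPdef] at hsum1
    omega
  -- `E = 6` at `K = 6`: the three non-neighbours are pairwise adjacent, `2P ≤ 3 (K + 1)`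
  have htri : E = 6 → 2 * P ≤ 3 * (K + 1) := by
    intro hE6'
    obtain ⟨u, v, w, huv, huw, hvw, hRuvw⟩ := card_eq_three.mp hRcard
    have hdeg2 : ∀ t ∈ R, degIn D R t = 2 := by
      intro t ht
      have hle : ∀ s ∈ R, degIn D R s ≤ 2 := fun s hs => by
        have := degIn_le_card_sub_one D hs
        rw [hRcard] at this
        exact this
      have hsum : ∑ s ∈ R, degIn D R s = 6 := by rw [← adjPairs_eq_sum_degIn, hEdef, hE6']
      by_contra hne
      have hlt : degIn D R t < 2 := lt_of_le_of_ne (hle t ht) hne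
      have : ∑ s ∈ R, degIn D R s < ∑ s ∈ R, 2 := by
        apply sum_lt_sum (fun s hs => hle s hs) ⟨t, ht, hlt⟩
      rw [sum_const, smul_eq_mul, hRcard] at this
      omega
    -- a vertex of `R` with two neighbours inside `R` is adjacent to both others
    have hadj : ∀ s ∈ R, ∀ t ∈ R, s ≠ t → D.Adj s t := by
      intro s hs t ht hst
      by_contra hnot
      have hsub : R.filter (fun q => D.Adj s q) ⊆ (R.erase s).erase t := by
        intro q hq
        rw [mem_filter] at hq
        rw [mem_erase, mem_erase]
        exact ⟨fun h => hnot (h ▸ hq.2), fun h => D.irrefl (h ▸ hq.2), hq.1⟩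
      have h1 := card_le_card hsub
      rw [card_erase_of_mem (mem_erase.mpr ⟨hst.symm, ht⟩), card_erase_of_mem hs, hRcard] at h1
      have h2 := hdeg2 s hs
      unfold degIn at h2
      omega
    have huR : u ∈ R := by rw [hRuvw]; simp
    have hvR : v ∈ R := by rw [hRuvw]; simp
    have hwR : w ∈ R := by rw [hRuvw]; simp
    have h1 := degIn_add_degIn_le_of_adj_pair D hK N (hadj u huR v hvR huv)
    have h2 := degIn_add_degIn_le_of_adj_pair D hK N (hadj u huR w hwR huw)
    have h3 := degIn_add_degIn_le_of_adj_pair D hK N (hadj v hvR w hwR hvw)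
    rw [hKdef] at h1 h2 h3
    have hPsum : P = degIn D N u + degIn D N v + degIn D N w := by
      rw [← hPdef, hRuvw, sum_insert (by simp [huv, huw]), sum_pair hvw]
      ring
    omega
  obtain ⟨hE0, hM1⟩ : E = 0 ∧ M ≤ 1 := by
    by_cases hE1 : 1 ≤ E
    · have h := hnoedge hE1
      rcases Nat.lt_or_ge K 7 with hK6 | hK7
      · have hK6' : K = 6 := by omega
        have hE6' : E = 6 := by omega
        have := htri hE6'
        omega
      · omega
    · omega
  have hnoR : ∀ u ∈ R, degIn D R u = 0 := by
    intro u hu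
    have hle : degIn D R u ≤ ∑ z ∈ R, degIn D R z := single_le_sum (fun _ _ => Nat.zero_le _) hu
    rw [← adjPairs_eq_sum_degIn, hEdef, hE0] at hle
    exact Nat.le_zero.mp hle
  rcases Nat.eq_zero_or_pos M with hM0 | hMpos
  · -- `M = 0`: `D ⊆ K(Nᶜ, N)`
    left
    have hnoN : ∀ y ∈ N, ∀ y', D.Adj y y' → y' ∉ N := by
      intro y hy y' hyy' hy'
      have h0 : degIn D N y = 0 := by
        have hle : degIn D N y ≤ ∑ z ∈ N, degIn D N z := single_le_sum (fun _ _ => Nat.zero_le _) hy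
        rw [hTf, hM0, mul_zero] at hle
        exact Nat.le_zero.mp hle
      unfold degIn at h0
      rw [card_eq_zero, filter_eq_empty_iff] at h0
      exact h0 hy' hyy'
    have hnoR' : ∀ u ∈ R, ∀ u', D.Adj u u' → u' ∉ R := by
      intro u hu u' huu' hu'
      have h0 := hnoR u hu
      unfold degIn at h0
      rw [card_eq_zero, filter_eq_empty_iff] at h0
      exact h0 hu' huu'
    refine ⟨Nᶜ, ?_, ?_⟩
    · rw [card_compl, hKdef]
      omega
    · intro p q hpq
      rw [mem_compl, mem_compl, not_not]
      constructor
      · intro hpN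
        by_contra hqN
        by_cases hpx : p = x
        · subst hpx
          exact hqN ((hmemN q).mpr hpq)
        by_cases hqx : q = x
        · subst hqx
          exact hpN ((hmemN p).mpr (D.adj_symm hpq))
        have hpR : p ∈ R := (hmemR p).mpr ⟨hpx, fun h => hpN ((hmemN p).mpr h)⟩
        have hqR : q ∈ R := (hmemR q).mpr ⟨hqx, fun h => hqN ((hmemN q).mpr h)⟩
        exact hnoR' p hpR q hpq hqR
      · intro hqN hpN
        exact hnoN p hpN q hpq hqN
  · -- `M = 1` with every degree `≥ 3`: the matched pair has `1 ≤ g ≤ 2` on both ends — `4` below the value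
    right
    have hM1' : M = 1 := by omega
    subst hM1'
    have hSR : ∑ u ∈ R, deg D u * deg D u ≤ (K - 1) * P := by
      have h : ∀ u ∈ R, deg D u * deg D u ≤ (K - 1) * degIn D N u := by
        intro u hu
        have e : deg D u = degIn D N u := by rw [hdegR u hu, hnoR u hu, add_zero]
        have hle : degIn D N u ≤ K - 1 := by have := hPle u hu; omega
        rw [e]
        exact Nat.mul_le_mul_right _ hle
      calc ∑ u ∈ R, deg D u * deg D u ≤ ∑ u ∈ R, (K - 1) * degIn D N u := sum_le_sum h
        _ = (K - 1) * P := by rw [← mul_sum, hPdef]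
    have hfg : ∑ y ∈ N, degIn D N y * degIn D R y ≤ 3 := by
      have := two_mul_sum_degIn_mul_degIn_le D hK x R (fun u hu => ((hmemR u).mp hu).1)
      rw [← hN, hM, hRcard] at this
      omega
    -- a matched vertex has `1 ≤ g ≤ 2`
    have hmatched : ∀ y ∈ N, degIn D N y = 1 → 1 ≤ degIn D R y ∧ degIn D R y ≤ 2 := by
      intro y hy hf
      obtain ⟨y', hy'N, hyy'⟩ : ∃ y' ∈ N, D.Adj y y' := by
        have hfpos : 0 < degIn D N y := by omega
        unfold degIn at hfpos
        obtain ⟨y', hy'⟩ := card_pos.mp hfpos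
        rw [mem_filter] at hy'
        exact ⟨y', hy'.1, hy'.2⟩
      have hpair := degIn_add_degIn_le_card_of_nbhd_edge D hK x R (fun u hu => ((hmemR u).mp hu).1)
        ((hmemN y).mp hy) ((hmemN y').mp hy'N) hyy'
      rw [hRcard] at hpair
      have h3 := hdeg3 y
      have h3' := hdeg3 y'
      rw [hdegN y hy] at h3
      rw [hdegN y' hy'N] at h3'
      have hf' := hfle y' hy'N
      omega
    have hSN : ∑ y ∈ N, deg D y * deg D y + 2 * ∑ y ∈ N, degIn D N y ≤ K + 12 + 5 * P := by
      have h : ∀ y ∈ N, deg D y * deg D y + 2 * degIn D N y ≤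
          1 + 3 * degIn D N y + 5 * degIn D R y + 2 * (degIn D N y * degIn D R y) := by
        intro y hy
        rw [hdegN y hy]
        have hf := hfle y hy
        have hg : degIn D R y ≤ 3 := by
          have := degIn_le_card D R y
          rw [hRcard] at this
          exact this
        rcases Nat.eq_zero_or_pos (degIn D N y) with hf0 | hfpos
        · rw [hf0]
          have := cap_sq_bound 0 (degIn D R y) (by norm_num) hg
          omega
        · have hf1 : degIn D N y = 1 := by omega
          obtain ⟨hg1, hg2⟩ := hmatched y hy hf1
          rw [hf1]
          interval_cases (degIn D R y) <;> norm_num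
      calc ∑ y ∈ N, deg D y * deg D y + 2 * ∑ y ∈ N, degIn D N y
          = ∑ y ∈ N, (deg D y * deg D y + 2 * degIn D N y) := by rw [sum_add_distrib, mul_sum]
        _ ≤ ∑ y ∈ N, (1 + 3 * degIn D N y + 5 * degIn D R y + 2 * (degIn D N y * degIn D R y)) := sum_le_sum h
        _ = N.card + 3 * ∑ y ∈ N, degIn D N y + 5 * ∑ y ∈ N, degIn D R y +
            2 * ∑ y ∈ N, degIn D N y * degIn D R y := by
          rw [sum_add_distrib, sum_add_distrib, sum_add_distrib, sum_const, smul_eq_mul, mul_one, mul_sum,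
            mul_sum, mul_sum]
        _ ≤ K + 12 + 5 * P := by
          rw [hKdef, hTf, sum_degIn_comm D N R, hPdef]
          omega
    rw [hTf] at hSN
    rw [hsplit (fun v => deg D v * deg D v), hdx, hKdef, hmdef, hcardV]
    rw [hE0] at hdegsum
    have hSN' : ∑ y ∈ N, deg D y * deg D y + 4 ≤ K + 12 + 5 * P := by omega
    obtain ⟨t, hK7⟩ : ∃ t, K = t + 6 := ⟨K - 6, by omega⟩
    have hP' : P = 3 * t + 15 := by omega
    have hm' : m = 4 * t + 22 := by omega
    subst hK7
    rw [hP'] at hSN' hSR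
    rw [hm']
    have e1 : t + 6 + 4 - 3 = t + 7 := by omega
    have e2 : t + 6 + 4 - 9 = t + 1 := by omega
    have e3 : t + 6 - 1 = t + 5 := by omega
    rw [e1, e2]
    rw [e3] at hSR
    nlinarith [hSN', hSR]

end C047

end TriangleCap

end PercRepro
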